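import Summits.Ventures.QEC.Census.CertScan
import HarnessLib

/-!
# Word layer of the Brouwer–Zimmermann branch of the CSS distance-certificate checker
# (plan/CERT-FORMAT.md v1.1 §5.3, BZ-CHECKER-SPEC §C3/§C4): row selections, the fast weight test, bit sets

The Brouwer–Zimmermann replay (`Census/CertCheckBZ.lean`) enumerates CODEWORDS `u·G` of a generator matrix `G`
(rows as binary numerals) for all selection words `u` of weight `≤ t`, and asks of each codeword only whether its
weight exceeds `wmax`. This file supplies the words-level functions it computes with and their meaning:

* `xorSel rows m` — the XOR of the rows selected by the set bits of `m` (= `u·G` for `u = ofBits |rows| m`: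
  `ofBits_xorSel_eq_vecMul`, hence additive in `m` at the vector level); `rowPos G` — the position list `(2^j, G[j])` the enumeration `scan`s, with the
  support-list bridge `ofBits_xorFst_rowSupp` / `ofBits_xorSnd_rowSupp` / `length_rowSupp` (the analogue for ROWS
  of `Census/CertScan.lean`'s column bridge);
* `wtGt w c` — "`c` has more than `w` set bits", by clearing the lowest set bit `w + 1` times (`c &&& (c − 1)`,
  `O(w)` kernel-accelerated operations instead of an `n`-step bit count): `lt_popc_of_wtGt`;
* `bitSet n m : Finset (Fin n)` — the set of bit positions, with `card_bitSet = popc`, `bitSet_and/or/xor`, so that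
  the relative-rank bound of the checker (computed on masks) can be proved by finite-set counting.

Everything is structural recursion on `List`/`Nat` (kernel-reducible); no axioms beyond the standard three.
-/

namespace Summit.Ventures.QEC.Census

open Matrix Literature.InformationTheory.QuantumCodes

/-! ## Row selections -/

/-- XOR of the rows selected by the set bits of the word `m`: `xorSel rows m = ⊕_{bit i of m set} rows[i]`.
(definition, structural on the row list) -/
def xorSel : List ℕ → ℕ → ℕ
  | [], _ => 0
  | r :: rs, m => (if m % 2 = 1 then r else 0) ^^^ xorSel rs (m / 2)

/-- The position list of a row list for the enumeration: `(2^j, G[j])` for `j = 0, 1, …` (first component = the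
selection bit, second = the row word), started at index `j₀`. (definition) -/
def rowPos : List ℕ → ℕ → List (ℕ × ℕ)
  | [], _ => []
  | g :: gs, j => (2 ^ j, g) :: rowPos gs (j + 1)

/-- `rowPos` is the map `j ↦ (2^j, G[j])` over the index range. -/
theorem rowPos_eq_map (G : List ℕ) (j₀ : ℕ) :
    rowPos G j₀ = (List.range' j₀ G.length).map fun j => (2 ^ j, G.getD (j - j₀) 0) := by
  induction G generalizing j₀ with
  | nil => simp [rowPos]
  | cons g gs ih =>
    rw [rowPos, List.length_cons, List.range'_succ, List.map_cons, ih (j₀ + 1)]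
    simp only [Nat.sub_self, List.getD_cons_zero]
    congr 1
    refine List.map_congr_left fun j hj => ?_
    rw [List.mem_range'_1] at hj
    obtain ⟨d, rfl⟩ : ∃ d, j = j₀ + 1 + d := ⟨j - (j₀ + 1), by omega⟩
    simp [show j₀ + 1 + d - j₀ = d + 1 by omega]

/-- `rowPos G 0` is the map `j ↦ (2^j, G[j])` over `range |G|`. -/
theorem rowPos_zero (G : List ℕ) : rowPos G 0 = (List.range G.length).map fun j => (2 ^ j, G.getD j 0) := by
  rw [rowPos_eq_map, List.range_eq_range']
  simp

/-- The word of a selection is its vector times the matrix: `ofBits n (xorSel G m) = (ofBits |G| m) ᵥ* G`. -/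
theorem ofBits_xorSel_eq_vecMul (n : ℕ) (G : List ℕ) (m : ℕ) :
    ofBits n (xorSel G m) = ofBits G.length m ᵥ* rowMatrix n G := by
  induction G generalizing m with
  | nil =>
    funext j
    simp [xorSel, ofBits_zero, vecMul, dotProduct]
  | cons g gs ih =>
    rw [xorSel, ofBits_xor, ih (m / 2)]
    funext j
    simp only [Pi.add_apply, vecMul, dotProduct, List.length_cons, Fin.sum_univ_succ]
    congr 1
    · -- the head row, selected by bit 0
      simp only [ofBits, Fin.val_zero, Nat.testBit_zero, rowMatrix, Fin.getElem_fin, List.getElem_cons_zero,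
        decide_eq_true_eq]
      by_cases h : m % 2 = 1
      · simp [h]
      · simp [h]
    · refine Finset.sum_congr rfl fun i _ => ?_
      have h1 : ofBits (gs.length + 1) m i.succ = ofBits gs.length (m / 2) i := by
        simp only [ofBits, Fin.val_succ, Nat.testBit_succ]
      have h2 : rowMatrix n (g :: gs) i.succ j = rowMatrix n gs i j := rfl
      exact (congrArg₂ (· * ·) h1 h2).symm

/-- A selected XOR of rows lies in the row space. -/
theorem ofBits_xorSel_mem_rowSpace (n : ℕ) (G : List ℕ) (m : ℕ) :
    ofBits n (xorSel G m) ∈ rowSpace (rowMatrix n G) := by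
  rw [ofBits_xorSel_eq_vecMul]
  exact mem_rowSpace_of_vecMul_eq _ rfl

/-- Words of bounded size are preserved by `xorSel`. -/
theorem xorSel_lt (n : ℕ) (G : List ℕ) (hG : ∀ g ∈ G, g < 2 ^ n) (m : ℕ) : xorSel G m < 2 ^ n := by
  induction G generalizing m with
  | nil => simp [xorSel]
  | cons g gs ih =>
    rw [xorSel]
    refine Nat.xor_lt_two_pow ?_ (ih (fun x hx => hG x (by simp [hx])) _)
    split
    · exact hG g (by simp)
    · exact Nat.two_pow_pos n

/-! ## The support list of a selection vector over the rows (bridge for the enumeration) -/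

/-- The sub-position-list of `rowPos G 0` selected by a vector `u : Fin |G| → ZMod 2` (its support). -/
def rowSupp (G : List ℕ) (u : Fin G.length → ZMod 2) : List (ℕ × ℕ) :=
  (suppIdx G.length u).map fun j => (2 ^ j, G.getD j 0)

/-- The support list is a sublist of the position list. -/
theorem rowSupp_sublist (G : List ℕ) (u : Fin G.length → ZMod 2) : (rowSupp G u).Sublist (rowPos G 0) := by
  rw [rowSupp, suppIdx, rowPos_zero, ← List.map_coe_finRange_eq_range]
  exact ((List.filter_sublist).map _).map _

/-- Its length is the Hamming weight of `u`. -/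
theorem length_rowSupp (G : List ℕ) (u : Fin G.length → ZMod 2) : (rowSupp G u).length = hammingNorm u := by
  rw [rowSupp, List.length_map, suppIdx, List.length_map, hammingNorm,
    ← List.toFinset_card_of_nodup ((List.nodup_finRange _).filter _), List.toFinset_filter, List.toFinset_finRange]
  congr 1
  ext i
  simp

/-- The selection word of the support list is `u` itself (as a word over `|G|` bits). -/
theorem ofBits_xorFst_rowSupp (G : List ℕ) (u : Fin G.length → ZMod 2) :
    ofBits G.length (xorFst (rowSupp G u)) = u := by
  have hx : xorFst (rowSupp G u) = xorList ((suppIdx G.length u).map fun j => 2 ^ j) := by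
    rw [xorFst, rowSupp, List.map_map]
    rfl
  funext i
  rw [hx, ofBits, testBit_xorList_pow _ (nodup_suppIdx _ u)]
  by_cases hi : u i = 0
  · have : ¬ ((i : ℕ) ∈ suppIdx G.length u) := fun h => (mem_suppIdx_iff _ u i).1 h hi
    simp [this, hi]
  · have hmem : (i : ℕ) ∈ suppIdx G.length u := (mem_suppIdx_iff _ u i).2 hi
    have h01 : ∀ x : ZMod 2, x ≠ 0 → x = 1 := by decide
    simp [hmem, h01 _ hi]

/-- For row indices `J` (all `< |G|`): `ofBits n (⊕_{j∈J} G[j]) = (ofBits |G| (⊕_{j∈J} 2^j)) ᵥ* G`. -/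
theorem ofBits_xorList_rows (n : ℕ) (G : List ℕ) (J : List ℕ) (hJ : ∀ j ∈ J, j < G.length) :
    ofBits n (xorList (J.map fun j => G.getD j 0)) =
      ofBits G.length (xorList (J.map fun j => 2 ^ j)) ᵥ* rowMatrix n G := by
  induction J with
  | nil => simp [xorList, ofBits_zero]
  | cons a J ih =>
    have ha : a < G.length := hJ a (by simp)
    rw [List.map_cons, List.map_cons, xorList, xorList, ofBits_xor, ofBits_xor, Matrix.add_vecMul,
      ih fun j hj => hJ j (by simp [hj]), ofBits_two_pow G.length a ha, Matrix.single_one_vecMul]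
    congr 1
    have hget : G.getD a 0 = G[a] := by
      rw [List.getD_eq_getElem?_getD, List.getElem?_eq_getElem ha, Option.getD_some]
    rw [hget]
    rfl

/-- The codeword of the support list is `u ᵥ* G`. -/
theorem ofBits_xorSnd_rowSupp (n : ℕ) (G : List ℕ) (u : Fin G.length → ZMod 2) :
    ofBits n (xorSnd (rowSupp G u)) = u ᵥ* rowMatrix n G := by
  have hx : xorSnd (rowSupp G u) = xorList ((suppIdx G.length u).map fun j => G.getD j 0) := by
    rw [xorSnd, rowSupp, List.map_map]
    rfl
  rw [hx, ofBits_xorList_rows n G _ fun j hj => lt_of_mem_suppIdx _ u hj]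
  congr 1
  have := ofBits_xorFst_rowSupp G u
  rw [xorFst, rowSupp, List.map_map] at this
  exact this

/-! ## The fast weight test -/

/-- `wtGt w c`: the word `c` has MORE than `w` set bits — tested by clearing the lowest set bit (`c &&& (c − 1)`)
up to `w + 1` times. (definition, structural on `w`) -/
def wtGt : ℕ → ℕ → Bool
  | 0, c => !(c == 0)
  | w + 1, c => !(c == 0) && wtGt w (c &&& (c - 1))

/-- Bit count of `0`. -/
theorem popc_zero (n : ℕ) : popc n 0 = 0 := by
  induction n with
  | zero => rfl
  | succ n ih => simp [popc, ih]

/-- A nonzero word below `2^n` has a set bit below `n`. -/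
theorem popc_pos (n : ℕ) {c : ℕ} (hc : c ≠ 0) (hlt : c < 2 ^ n) : 0 < popc n c := by
  induction n generalizing c with
  | zero => omega
  | succ n ih =>
    rw [popc]
    rcases Nat.mod_two_eq_zero_or_one c with h | h
    · have hc2 : c / 2 ≠ 0 := by omega
      have hlt2 : c / 2 < 2 ^ n := by rw [Nat.pow_succ] at hlt; omega
      have := ih hc2 hlt2
      omega
    · omega

/-- **Clearing the lowest set bit removes exactly one bit**: `popc n (c &&& (c − 1)) + 1 = popc n c` for
`0 < c < 2^n`. -/
theorem popc_and_pred (n : ℕ) {c : ℕ} (hc : c ≠ 0) (hlt : c < 2 ^ n) :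
    popc n (c &&& (c - 1)) + 1 = popc n c := by
  induction n generalizing c with
  | zero => omega
  | succ n ih =>
    have hmod : (c &&& (c - 1)) % 2 = c % 2 &&& (c - 1) % 2 := by
      simpa using (Nat.and_mod_two_pow (a := c) (b := c - 1) (n := 1))
    rw [popc, popc, Nat.and_div_two, hmod]
    rcases Nat.mod_two_eq_zero_or_one c with h | h
    · -- c even, c = 2q with q ≠ 0: c − 1 odd, (c − 1)/2 = q − 1
      have hq : c / 2 ≠ 0 := by omega
      have hq2 : c / 2 < 2 ^ n := by rw [Nat.pow_succ] at hlt; omega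
      have h1 : (c - 1) % 2 = 1 := by omega
      have h2 : (c - 1) / 2 = c / 2 - 1 := by omega
      rw [h, h1, h2, Nat.zero_and, ← ih hq hq2]
      omega
    · -- c odd: c − 1 = 2 (c/2), the AND keeps c/2
      have h1 : (c - 1) % 2 = 0 := by omega
      have h2 : (c - 1) / 2 = c / 2 := by omega
      rw [h, h1, h2, Nat.and_zero, Nat.and_self]
      omega

/-- **Soundness of the weight test**: if `wtGt w c` holds (and `c < 2^n`) then `c` has more than `w` bits below `n`. -/
theorem lt_popc_of_wtGt (n : ℕ) : ∀ (w c : ℕ), c < 2 ^ n → wtGt w c = true → w < popc n c := by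
  intro w
  induction w with
  | zero =>
    intro c hlt h
    simp only [wtGt, Bool.not_eq_true', beq_eq_false_iff_ne] at h
    exact popc_pos n h hlt
  | succ w ih =>
    intro c hlt h
    simp only [wtGt, Bool.and_eq_true, Bool.not_eq_true', beq_eq_false_iff_ne] at h
    have hlt' : c &&& (c - 1) < 2 ^ n := lt_of_le_of_lt Nat.and_le_left hlt
    have := ih _ hlt' h.2
    have := popc_and_pred n h.1 hlt
    omega

/-! ## Bit sets -/

/-- The set of bit positions (below `n`) of a word. (definition) -/
def bitSet (n m : ℕ) : Finset (Fin n) := Finset.univ.filter fun i => m.testBit i = true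

/-- Membership in the bit set. -/
@[simp] theorem mem_bitSet {n m : ℕ} {i : Fin n} : i ∈ bitSet n m ↔ m.testBit i = true := by
  simp [bitSet]

/-- The bit set of a word is the support of its vector, so its size is the bit count. -/
theorem card_bitSet (n m : ℕ) : (bitSet n m).card = popc n m := by
  rw [← hammingNorm_ofBits, hammingNorm]
  congr 1
  ext i
  simp [bitSet, ofBits_apply_ne_zero_iff]

/-- AND is intersection. -/
theorem bitSet_and (n a b : ℕ) : bitSet n (a &&& b) = bitSet n a ∩ bitSet n b := by
  ext i; simp [Nat.testBit_and]

/-- OR is union. -/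
theorem bitSet_or (n a b : ℕ) : bitSet n (a ||| b) = bitSet n a ∪ bitSet n b := by
  ext i; simp [Nat.testBit_or]

/-- XOR with a sub-mask is set difference: `bitSet (T ^^^ (T &&& U)) = bitSet T \ bitSet U`. -/
theorem bitSet_xor_and (n T U : ℕ) : bitSet n (T ^^^ (T &&& U)) = bitSet n T \ bitSet n U := by
  ext i
  simp only [mem_bitSet, Nat.testBit_xor, Nat.testBit_and, Finset.mem_sdiff]
  cases T.testBit i <;> cases U.testBit i <;> simp

/-- The bit set of `0` is empty. -/
theorem bitSet_zero (n : ℕ) : bitSet n 0 = ∅ := by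
  ext i; simp

/-- The support of the vector of a word is its bit set. -/
theorem support_ofBits (n m : ℕ) : (Finset.univ.filter fun i => ofBits n m i ≠ 0) = bitSet n m := by
  ext i
  simp [bitSet, ofBits_apply_ne_zero_iff]

end Summit.Ventures.QEC.Census
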